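import Summits.Ventures.DiscreteObjects.Hadamard.Order167ItoTypeShape668

/-!
# H(668): σ₁₆₇ with a centralising involution and a fixed-point-free inverting coset ⇒ an ITO TYPE-Q array with circulant
# blocks of order 167 (the sign table identified: quaternion cocycle; kernel)

Framing: lottery ticket; floor = certified bounds/negative ranges.

Cell pub-namedobj (venture DiscreteObjects), target (H), hadamard gen 22.  Sharpening of `Order167ItoTypeShape668` (shape with SOME
sign table) exactly as gen 21 sharpened `Order167WilliamsonType668` into `Order167WilliamsonIff668`: the three involution classes
`τ` (centralising), `ρ`, `ρτ` (inverting, fixed-point-free) are NEGA and `τ, ρ` ANTICOMMUTE as signed maps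
(`inverting_centralizing_anticommute` — from the nega relation of the fixed-point-free inverting involution `τρ`), so gen 21's
`quaternion_cocycle` applies verbatim to the column sign vectors and the sign table is the Williamson table `θ_W`:
* **`exists_itoArray_of_inverting_fpf`**: `H` is equivalent to the Hadamard matrix
  `M ((g,s),(h,t)) = θ_W(g,h) · A_{g+h}(ε_g (t − s))`, `ε_g = ±1` according to `g₂ = 0 / 1` — i.e. to
  `(A B C D / −B A −D C / −Cᵀ Dᵀ Aᵀ −Bᵀ / −Dᵀ −Cᵀ Bᵀ Aᵀ)` with circulant `A, B, C, D` of order `167`, which after negating the last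
  three block-rows is ITO's TYPE-Q ARRAY `(A B C D / B −A D −C / Cᵀ −Dᵀ −Aᵀ Bᵀ / Dᵀ Cᵀ −Bᵀ −Aᵀ)` (Ito 1981; Horadam 2007 (2.17)).
So: **an H(668) with an element of order 167, a centralising involution and an inverting automorphism `ρ` with `ρ, ρτ`
fixed-point-free exists only if an Ito type-Q Hadamard matrix of order `668 = 4·167` exists** (Ito's conjecture, Horadam 2007
Research Problem 6, is open at `w = 167`: `2w − 1 = 333` and `4w − 1 = 667` are not prime powers).  The converse and the iff are
the companion file `Order167ItoTypeIff668B`.  DICTIONARY; H(668) untouched; HITS 0/4.  The regular `D_{4w}`-action / dicyclic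
cocycle is Ito–Flannery–Horadam's framework (replication-adjacent in conclusion; hypothesis and route ours); no `sorry`, no
definitions, default heartbeats.
-/

namespace Summit.Ventures.DiscreteObjects.Hadamard

open Finset BigOperators Matrix

open Literature.Combinatorics.Designs.GoethalsSeidel (IsHadamardMatrix)

variable {ι : Type*} [Fintype ι] [DecidableEq ι]

section main
variable {H : Matrix ι ι ℤ} (hH : IsHadamardMatrix H) (hι : Fintype.card ι = 668)
  {π κ : Equiv.Perm ι} {d e : ι → ℤ} (haut : IsSignedAut H π κ d e)
  (hπ : π ^ 167 = 1) (hκ : κ ^ 167 = 1) (hne : π ≠ 1 ∨ κ ≠ 1)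
  {π₁ κ₁ π₂ κ₂ : Equiv.Perm ι} {d₁ e₁ d₂ e₂ : ι → ℤ}
  (h₁ : IsSignedAut H π₁ κ₁ d₁ e₁) (hc₁ : Commute π₁ π) (hc₁' : Commute κ₁ κ) (hi₁ : π₁ ^ 2 = 1) (hi₁' : κ₁ ^ 2 = 1)
  (hne₁ : π₁ ≠ 1 ∨ κ₁ ≠ 1)
  (h₂ : IsSignedAut H π₂ κ₂ d₂ e₂) {μ : ℕ} (hn₂ : π₂ * π = π ^ μ * π₂) (hn₂' : κ₂ * κ = κ ^ μ * κ₂) (hμ : μ % 167 = 166)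
  (hfp : ∀ x, π₂ x ≠ x) (hfp' : ∀ x, (π₂ * π₁) x ≠ x)
include hH hι haut hπ hκ hne h₁ hc₁ hc₁' hi₁ hi₁' hne₁ h₂ hn₂ hn₂' hμ hfp hfp'

/-- **`τ` and `ρ` anticommute as signed maps**: the row-sign vector `i ↦ d₁ (π₂ i) · d₂ i` of `τρ` is minus the row-sign vector
`i ↦ d₂ (π₁ i) · d₁ i` of `ρτ`, and likewise for columns (all three of `τ, ρ, τρ` are nega involution pairs). -/
theorem inverting_centralizing_anticommute :
    (∀ i, d₁ (π₂ i) * d₂ i = -(d₂ (π₁ i) * d₁ i)) ∧ (∀ j, e₁ (κ₂ j) * e₂ j = -(e₂ (κ₁ j) * e₁ j)) := by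
  obtain ⟨hi₂, hi₂'⟩ := hadamard668_order167_inverting_sq_eq_one hH hι haut hπ hκ hne h₂ hn₂ hn₂' hμ
  obtain ⟨hcm, hcm'⟩ := hadamard668_order167_inverting_commute_involution hH hι haut hπ hκ hne h₂ hn₂ hn₂' hμ h₁ hc₁ hc₁' hi₁
    hi₁'
  -- nega relations: τ (gen 21), ρ and τρ (all-or-none, fixed-point-free case)
  obtain ⟨-, hd₁, he₁⟩ := centralizer167_involution_nega hH hι haut hπ hκ hne h₁ hc₁ hi₁ hi₁' hne₁
  have hd₂e₂ : (∀ i, d₂ (π₂ i) = -d₂ i) ∧ (∀ j, e₂ (κ₂ j) = -e₂ j) := by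
    rcases hadamard668_order167_inverting_all_or_none hH hι haut hπ hκ hne h₂ hn₂ hn₂' hμ with ⟨-, -, h4, -⟩ | ⟨-, -, -, -, hd, he⟩
    · exfalso
      obtain ⟨x, hx⟩ : (univ.filter fun x => π₂ x = x).Nonempty := by rw [← Finset.card_pos, h4]; norm_num
      exact hfp x (Finset.mem_filter.mp hx).2
    · exact ⟨hd, he⟩
  obtain ⟨hd₂, he₂⟩ := hd₂e₂
  have hn₁ : π₁ * π = π ^ 1 * π₁ := by rw [pow_one]; exact hc₁.eq
  have hn₁' : κ₁ * κ = κ ^ 1 * κ₁ := by rw [pow_one]; exact hc₁'.eq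
  have hn : (π₁ * π₂) * π = π ^ μ * (π₁ * π₂) := by have h := norm_mul hn₁ hn₂; rwa [one_mul] at h
  have hn' : (κ₁ * κ₂) * κ = κ ^ μ * (κ₁ * κ₂) := by have h := norm_mul hn₁' hn₂'; rwa [one_mul] at h
  have hfp'' : ∀ x, (π₁ * π₂) x ≠ x := by rw [← hcm.eq]; exact hfp'
  have hd₁₂e₁₂ : (∀ i, d₁ (π₂ (( π₁ * π₂) i)) * d₂ ((π₁ * π₂) i) = -(d₁ (π₂ i) * d₂ i)) ∧
      (∀ j, e₁ (κ₂ ((κ₁ * κ₂) j)) * e₂ ((κ₁ * κ₂) j) = -(e₁ (κ₂ j) * e₂ j)) := by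
    rcases hadamard668_order167_inverting_all_or_none hH hι haut hπ hκ hne (isSignedAut_mul h₁ h₂) hn hn' hμ with
      ⟨-, -, h4, -⟩ | ⟨-, -, -, -, hd, he⟩
    · exfalso
      obtain ⟨x, hx⟩ : (univ.filter fun x => (π₁ * π₂) x = x).Nonempty := by rw [← Finset.card_pos, h4]; norm_num
      exact hfp'' x (Finset.mem_filter.mp hx).2
    · exact ⟨hd, he⟩
  obtain ⟨hd₁₂, he₁₂⟩ := hd₁₂e₁₂
  refine ⟨fun i => ?_, fun j => ?_⟩
  · have h := hd₁₂ i
    simp only [Equiv.Perm.mul_apply] at h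
    have e1 : π₂ (π₁ (π₂ i)) = π₁ i := by
      rw [← Equiv.Perm.mul_apply, hcm.eq, Equiv.Perm.mul_apply, ← Equiv.Perm.mul_apply π₂ π₂, ← pow_two, hi₂,
        Equiv.Perm.one_apply]
    rw [e1, hd₁ i] at h
    have e2 : π₁ (π₂ i) = π₂ (π₁ i) := by rw [← Equiv.Perm.mul_apply, ← hcm.eq, Equiv.Perm.mul_apply]
    rw [e2, hd₂ (π₁ i)] at h
    have hsq1 := pm_mul_self (h₁.1 i)
    have hsq2 := pm_mul_self (h₂.1 i)
    nlinarith [hsq1, hsq2, h]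
  · have h := he₁₂ j
    simp only [Equiv.Perm.mul_apply] at h
    have e1 : κ₂ (κ₁ (κ₂ j)) = κ₁ j := by
      rw [← Equiv.Perm.mul_apply, hcm'.eq, Equiv.Perm.mul_apply, ← Equiv.Perm.mul_apply κ₂ κ₂, ← pow_two, hi₂',
        Equiv.Perm.one_apply]
    rw [e1, he₁ j] at h
    have e2 : κ₁ (κ₂ j) = κ₂ (κ₁ j) := by rw [← Equiv.Perm.mul_apply, ← hcm'.eq, Equiv.Perm.mul_apply]
    rw [e2, he₂ (κ₁ j)] at h
    have hsq1 := pm_mul_self (h₁.2.1 j)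
    have hsq2 := pm_mul_self (h₂.2.1 j)
    nlinarith [hsq1, hsq2, h]

/-- **Ito array.**  `H` is equivalent to the Hadamard matrix `[θ_W(g,h) · A'_{g+h}(ε_g (t − s))]` on `(ℤ/2 × ℤ/2) × ℤ/167`
(`θ_W` the Williamson sign table of `WilliamsonArrayQuaternion668`, `ε_g = +1` for `g₂ = 0`, `−1` for `g₂ = 1`): Ito's type-Q array
with circulant blocks of order `167`, up to negating three block-rows. -/
theorem exists_itoArray_of_inverting_fpf :
    ∃ A' : ZMod 2 × ZMod 2 → ZMod 167 → ℤ,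
      IsHadamardMatrix (Matrix.of fun (a b : (ZMod 2 × ZMod 2) × ZMod 167) =>
        (if a.1 = 0 then (1 : ℤ) else if a.1 = (1, 0) then (if b.1.1 = 1 then 1 else -1)
          else if a.1 = (0, 1) then (if b.1.1 = b.1.2 then -1 else 1) else (if b.1.2 = 1 then 1 else -1)) *
        A' (a.1 + b.1) (if a.1.2 = 0 then b.2 - a.2 else a.2 - b.2)) := by
  have p167 : Nat.Prime 167 := by norm_num
  have hcard : (Fintype.card ι : ℤ) ≠ 0 := by rw [hι]; norm_num
  obtain ⟨hi₂, hi₂'⟩ := hadamard668_order167_inverting_sq_eq_one hH hι haut hπ hκ hne h₂ hn₂ hn₂' hμ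
  obtain ⟨hcm, hcm'⟩ := hadamard668_order167_inverting_commute_involution hH hι haut hπ hκ hne h₂ hn₂ hn₂' hμ h₁ hc₁ hc₁' hi₁
    hi₁'
  -- sign relations (column side)
  obtain ⟨-, -, hN1⟩ := centralizer167_involution_nega hH hι haut hπ hκ hne h₁ hc₁ hi₁ hi₁' hne₁
  have hN2 : ∀ z, e₂ (κ₂ z) = -e₂ z := by
    rcases hadamard668_order167_inverting_all_or_none hH hι haut hπ hκ hne h₂ hn₂ hn₂' hμ with ⟨-, -, h4, -⟩ | ⟨-, -, -, -, -, he⟩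
    · exfalso
      obtain ⟨x, hx⟩ : (univ.filter fun x => π₂ x = x).Nonempty := by rw [← Finset.card_pos, h4]; norm_num
      exact hfp x (Finset.mem_filter.mp hx).2
    · exact he
  obtain ⟨-, hAC⟩ := inverting_centralizing_anticommute hH hι haut hπ hκ hne h₁ hc₁ hc₁' hi₁ hi₁' hne₁ h₂ hn₂ hn₂' hμ hfp hfp'
  -- the inverting involutions fix no column either
  have hn₁ : π₁ * π = π ^ 1 * π₁ := by rw [pow_one]; exact hc₁.eq
  have hn₁' : κ₁ * κ = κ ^ 1 * κ₁ := by rw [pow_one]; exact hc₁'.eq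
  have hn : (π₂ * π₁) * π = π ^ μ * (π₂ * π₁) := by have h := norm_mul hn₂ hn₁; rwa [mul_one] at h
  have hn' : (κ₂ * κ₁) * κ = κ ^ μ * (κ₂ * κ₁) := by have h := norm_mul hn₂' hn₁'; rwa [mul_one] at h
  have hfpC : ∀ y, κ₂ y ≠ y := by
    rcases hadamard668_order167_inverting_all_or_none hH hι haut hπ hκ hne h₂ hn₂ hn₂' hμ with ⟨-, -, h4, -⟩ | ⟨-, -, -, h0, -⟩
    · exfalso
      obtain ⟨x, hx⟩ : (univ.filter fun x => π₂ x = x).Nonempty := by rw [← Finset.card_pos, h4]; norm_num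
      exact hfp x (Finset.mem_filter.mp hx).2
    · exact moved_of_card_fixed_eq_zero κ₂ h0
  have hfpC' : ∀ y, (κ₂ * κ₁) y ≠ y := by
    rcases hadamard668_order167_inverting_all_or_none hH hι haut hπ hκ hne (isSignedAut_mul h₂ h₁) hn hn' hμ with
      ⟨-, -, h4, -⟩ | ⟨-, -, -, h0, -⟩
    · exfalso
      obtain ⟨x, hx⟩ : (univ.filter fun x => (π₂ * π₁) x = x).Nonempty := by rw [← Finset.card_pos, h4]; norm_num
      exact hfp' x (Finset.mem_filter.mp hx).2
    · exact moved_of_card_fixed_eq_zero _ h0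
  -- re-sign: σ is a permutation automorphism of H'
  obtain ⟨s, t, hs, ht, hH', hinv⟩ := exists_resign_of_odd hH haut (by decide : Odd 167) hπ hκ
  set H' : Matrix ι ι ℤ := Matrix.of fun i j => s i * t j * H i j with hH'def
  have hinv' : ∀ i j, H' (π i) (κ j) = H' i j := fun i j => by
    simp only [hH'def, Matrix.of_apply]; exact hinv i j
  have hinvm : ∀ m i j, H' ((π ^ m) i) ((κ ^ m) j) = H' i j := perm_aut_pow hinv'
  have hH'ne : ∀ i j, H' i j ≠ 0 := fun i j => pm_ne_zero (hH'.1 i j)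
  -- labels, signs, multipliers
  set P : ZMod 2 × ZMod 2 → Equiv.Perm ι := fun g => π₁ ^ g.1.val * π₂ ^ g.2.val with hPdef
  set Q : ZMod 2 × ZMod 2 → Equiv.Perm ι := fun g => κ₁ ^ g.1.val * κ₂ ^ g.2.val with hQdef
  set Eg : ZMod 2 × ZMod 2 → ι → ℤ := fun g j => cyc κ₁ e₁ ((κ₂ ^ g.2.val) j) g.1.val * cyc κ₂ e₂ j g.2.val with hEgdef
  set D' : ZMod 2 × ZMod 2 → ι → ℤ := fun g i =>
    s (P g i) * s i * (cyc π₁ d₁ ((π₂ ^ g.2.val) i) g.1.val * cyc π₂ d₂ i g.2.val) with hD'def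
  set E' : ZMod 2 × ZMod 2 → ι → ℤ := fun g j => t (Q g j) * t j * Eg g j with hE'def
  have hT' : ∀ g, IsSignedAut H' (P g) (Q g) (D' g) (E' g) :=
    fun g => signedAut_resign' hs ht (isSignedAut_mul (isSignedAut_pow h₁ g.1.val) (isSignedAut_pow h₂ g.2.val))
  have hnP : ∀ g, P g * π = π ^ (μ ^ g.2.val) * P g := by
    intro g
    have ha : π₁ ^ g.1.val * π = π ^ 1 * π₁ ^ g.1.val := by rw [pow_one]; exact (hc₁.pow_left _).eq
    have h := norm_mul ha (norm_pow_left hn₂ g.2.val)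
    rwa [one_mul] at h
  have hnQ : ∀ g, Q g * κ = κ ^ (μ ^ g.2.val) * Q g := by
    intro g
    have ha : κ₁ ^ g.1.val * κ = κ ^ 1 * κ₁ ^ g.1.val := by rw [pow_one]; exact (hc₁'.pow_left _).eq
    have h := norm_mul ha (norm_pow_left hn₂' g.2.val)
    rwa [one_mul] at h
  have hQadd : ∀ g h, Q (g + h) = Q g * Q h := fun g h => v4_label_add hi₁' hi₂' hcm'.symm g h
  obtain ⟨x₀⟩ : Nonempty ι := Fintype.card_pos_iff.mp (by rw [hι]; norm_num)
  set y₀ := x₀ with hy₀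
  have hconst : ∀ g, (∀ k x, D' g ((π ^ k) x) = D' g x) ∧ (∀ k y, E' g ((κ ^ k) y) = E' g y) :=
    fun g => signs_const_of_normalizing hH'ne hinv' (by decide : Odd 167) hπ (hT' g) (hnP g) (hnQ g) x₀
  have hμ' : (μ : ZMod 167) = -1 := by
    rw [← ZMod.natCast_mod μ 167, hμ]; exact zmod167_166
  have hμb : ∀ b k : ℕ, ((μ ^ b * (μ ^ b * k) : ℕ) : ZMod 167) = (k : ZMod 167) := by
    intro b k
    push_cast
    rw [← mul_assoc, ← pow_add, hμ', ← two_mul, pow_mul, neg_one_sq, one_pow, one_mul]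
  have hππ : ∀ b k : ℕ, π ^ (μ ^ b * (μ ^ b * k)) = π ^ k := fun b k => pow_eq_pow_of_natCast_eq_n hπ (hμb b k)
  have hκκ : ∀ b k : ℕ, κ ^ (μ ^ b * (μ ^ b * k)) = κ ^ k := fun b k => pow_eq_pow_of_natCast_eq_n hκ (hμb b k)
  -- the quaternion cocycle at the H' level (column signs)
  have hE'pm : ∀ g j, E' g j = 1 ∨ E' g j = -1 := fun g j => (hT' g).2.1 j
  have hcoc : ∀ g k y, E' g (Q k y) * E' k y =
      (if g = 0 ∨ k = 0 then (1 : ℤ) else if g = (1, 0) then (if k.1 = 1 then -1 else 1)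
        else if g = (0, 1) then (if k = (1, 1) then 1 else -1) else (if k = (1, 0) then 1 else -1)) * E' (g + k) y := by
    intro g k y
    have hq := quaternion_cocycle h₁.2.1 h₂.2.1 hcm'.symm hi₂' hN1 hN2 hAC g k y
    have htt := pm_mul_self (ht (Q k y))
    have hQQ : Q g (Q k y) = Q (g + k) y := by rw [hQadd]; rfl
    simp only [hE'def, hEgdef, hQdef] at hq hQQ ⊢
    rw [hQQ]
    calc t ((κ₁ ^ (g + k).1.val * κ₂ ^ (g + k).2.val) y) * t ((κ₁ ^ k.1.val * κ₂ ^ k.2.val) y) *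
          (cyc κ₁ e₁ ((κ₂ ^ g.2.val) ((κ₁ ^ k.1.val * κ₂ ^ k.2.val) y)) g.1.val *
            cyc κ₂ e₂ ((κ₁ ^ k.1.val * κ₂ ^ k.2.val) y) g.2.val) *
          (t ((κ₁ ^ k.1.val * κ₂ ^ k.2.val) y) * t y * (cyc κ₁ e₁ ((κ₂ ^ k.2.val) y) k.1.val * cyc κ₂ e₂ y k.2.val))
        = t ((κ₁ ^ (g + k).1.val * κ₂ ^ (g + k).2.val) y) * t y *
            (t ((κ₁ ^ k.1.val * κ₂ ^ k.2.val) y) * t ((κ₁ ^ k.1.val * κ₂ ^ k.2.val) y)) *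
            ((cyc κ₁ e₁ ((κ₂ ^ g.2.val) ((κ₁ ^ k.1.val * κ₂ ^ k.2.val) y)) g.1.val *
                cyc κ₂ e₂ ((κ₁ ^ k.1.val * κ₂ ^ k.2.val) y) g.2.val) *
              (cyc κ₁ e₁ ((κ₂ ^ k.2.val) y) k.1.val * cyc κ₂ e₂ y k.2.val)) := by ring
      _ = _ := by rw [htt, mul_one, hq]; ring
  have hθ : ∀ g h, E' g (Q (g + h) y₀) =
      (if g = 0 then (1 : ℤ) else if g = (1, 0) then (if h.1 = 1 then 1 else -1)
        else if g = (0, 1) then (if h.1 = h.2 then -1 else 1) else (if h.2 = 1 then 1 else -1)) *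
        E' h y₀ * E' (g + h) y₀ := by
    intro g h
    have hc := hcoc g (g + h) y₀
    rw [v4_facts.2.1 g h, ← thetaW_eq_cocycle g h] at hc
    have hsq := pm_mul_self (hE'pm (g + h) y₀)
    calc E' g (Q (g + h) y₀) = E' g (Q (g + h) y₀) * (E' (g + h) y₀ * E' (g + h) y₀) := by rw [hsq, mul_one]
      _ = (E' g (Q (g + h) y₀) * E' (g + h) y₀) * E' (g + h) y₀ := by ring
      _ = _ := by rw [hc]
  -- the bijections
  let fR : (ZMod 2 × ZMod 2) × ZMod 167 → ι := fun a => (π ^ a.2.val) (P a.1 x₀)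
  let fC : (ZMod 2 × ZMod 2) × ZMod 167 → ι := fun b => (κ ^ b.2.val) (Q b.1 y₀)
  have hcardV : Fintype.card ((ZMod 2 × ZMod 2) × ZMod 167) = 668 := by simp [ZMod.card]
  have hbR : Function.Bijective fR :=
    ito_orbitMap_bijective hH hι haut hπ hκ hne h₁ hc₁ hc₁' hi₁ hi₁' hne₁ h₂ hn₂ hn₂' hμ hfp hfp' x₀
  have hbC : Function.Bijective fC := by
    have hT := isHadamard_transpose hH hcard
    exact ito_orbitMap_bijective hT hι (isSignedAut_transpose haut) hκ hπ hne.symm (isSignedAut_transpose h₁) hc₁' hc₁ hi₁'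
      hi₁ hne₁.symm (isSignedAut_transpose h₂) hn₂' hn₂ hμ hfpC hfpC' y₀
  let ER : (ZMod 2 × ZMod 2) × ZMod 167 ≃ ι := Equiv.ofBijective fR hbR
  let EC : (ZMod 2 × ZMod 2) × ZMod 167 ≃ ι := Equiv.ofBijective fC hbC
  -- entries of the reindexed H'
  have hentry : ∀ a b : (ZMod 2 × ZMod 2) × ZMod 167,
      H' (ER a) (EC b) = D' a.1 x₀ * E' a.1 (Q (a.1 + b.1) y₀) *
        H' x₀ ((κ ^ (if a.1.2 = 0 then b.2 - a.2 else a.2 - b.2).val) (Q (a.1 + b.1) y₀)) := by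
    rintro ⟨g, s'⟩ ⟨h, t'⟩
    show H' ((π ^ s'.val) (P g x₀)) ((κ ^ t'.val) (Q h y₀)) =
      D' g x₀ * E' g (Q (g + h) y₀) * H' x₀ ((κ ^ (if g.2 = 0 then t' - s' else s' - t').val) (Q (g + h) y₀))
    have hQh : Q h = Q g * Q (g + h) := by rw [← hQadd, v4_facts.2.1]
    have e2 : (π ^ s'.val) (P g x₀) = P g ((π ^ (μ ^ g.2.val * s'.val)) x₀) := by
      rw [← Equiv.Perm.mul_apply (π ^ s'.val) (P g), ← hππ g.2.val s'.val, ← norm_comm_pow (hnP g) (μ ^ g.2.val * s'.val),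
        Equiv.Perm.mul_apply (P g) (π ^ (μ ^ g.2.val * s'.val))]
    have e1 : (κ ^ t'.val) (Q h y₀) = Q g ((κ ^ (μ ^ g.2.val * t'.val)) (Q (g + h) y₀)) := by
      rw [hQh, Equiv.Perm.mul_apply (Q g) (Q (g + h)), ← Equiv.Perm.mul_apply (κ ^ t'.val) (Q g), ← hκκ g.2.val t'.val,
        ← norm_comm_pow (hnQ g) (μ ^ g.2.val * t'.val), Equiv.Perm.mul_apply (Q g) (κ ^ (μ ^ g.2.val * t'.val))]
    rw [e1, e2, (hT' g).2.2, (hconst g).1, (hconst g).2]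
    have hexp : ((μ ^ g.2.val * t'.val : ℕ) : ZMod 167) =
        ((μ ^ g.2.val * s'.val + (if g.2 = 0 then t' - s' else s' - t').val : ℕ) : ZMod 167) := by
      by_cases hg : g.2 = 0
      · rw [if_pos hg, hg, ZMod.val_zero, pow_zero, one_mul, one_mul]
        push_cast
        rw [ZMod.natCast_zmod_val, ZMod.natCast_zmod_val, ZMod.natCast_zmod_val]; ring
      · have hg1 : g.2 = 1 := zmod2_eq_one_of_ne_zero _ hg
        rw [if_neg hg, hg1, ZMod.val_one, pow_one]
        push_cast
        rw [ZMod.natCast_zmod_val, ZMod.natCast_zmod_val, ZMod.natCast_zmod_val, hμ']; ring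
    have e3 : κ ^ (μ ^ g.2.val * t'.val) = κ ^ (μ ^ g.2.val * s'.val) * κ ^ (if g.2 = 0 then t' - s' else s' - t').val := by
      rw [← pow_add]; exact pow_eq_pow_of_natCast_eq_n hκ hexp
    rw [e3, Equiv.Perm.mul_apply (κ ^ (μ ^ g.2.val * s'.val)) (κ ^ (if g.2 = 0 then t' - s' else s' - t').val), hinvm]
  have hMhad : IsHadamardMatrix (H'.submatrix ER EC) := by
    refine ⟨fun a b => hH'.1 _ _, ?_⟩
    rw [Matrix.transpose_submatrix, Matrix.submatrix_mul_equiv, hH'.2]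
    ext a b
    rw [Matrix.submatrix_apply, Matrix.smul_apply, Matrix.one_apply, Matrix.smul_apply, Matrix.one_apply, hι]
    simp only [EmbeddingLike.apply_eq_iff_eq]
    simp [ZMod.card]
  -- the Ito array of A' is the re-signed M
  refine ⟨fun k r => E' k y₀ * H' x₀ ((κ ^ r.val) (Q k y₀)), ?_⟩
  have hW : (Matrix.of fun (a b : (ZMod 2 × ZMod 2) × ZMod 167) =>
        (if a.1 = 0 then (1 : ℤ) else if a.1 = (1, 0) then (if b.1.1 = 1 then 1 else -1)
          else if a.1 = (0, 1) then (if b.1.1 = b.1.2 then -1 else 1) else (if b.1.2 = 1 then 1 else -1)) *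
        (E' (a.1 + b.1) y₀ *
          H' x₀ ((κ ^ (if a.1.2 = 0 then b.2 - a.2 else a.2 - b.2).val) (Q (a.1 + b.1) y₀)))) =
      Matrix.of fun a b => D' a.1 x₀ * E' b.1 y₀ * (H'.submatrix ER EC) a b := by
    ext a b
    rw [Matrix.of_apply, Matrix.of_apply, Matrix.submatrix_apply, hentry, hθ]
    have hdd := pm_mul_self ((hT' a.1).1 x₀)
    have hee := pm_mul_self (hE'pm b.1 y₀)
    set θv := (if a.1 = 0 then (1 : ℤ) else if a.1 = (1, 0) then (if b.1.1 = 1 then 1 else -1)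
          else if a.1 = (0, 1) then (if b.1.1 = b.1.2 then -1 else 1) else (if b.1.2 = 1 then 1 else -1)) with hθv
    set w := H' x₀ ((κ ^ (if a.1.2 = 0 then b.2 - a.2 else a.2 - b.2).val) (Q (a.1 + b.1) y₀)) with hw
    calc θv * (E' (a.1 + b.1) y₀ * w)
        = θv * (E' (a.1 + b.1) y₀ * w) * ((D' a.1 x₀ * D' a.1 x₀) * (E' b.1 y₀ * E' b.1 y₀)) := by
          rw [hdd, hee, mul_one, mul_one]
      _ = D' a.1 x₀ * E' b.1 y₀ * (D' a.1 x₀ * (θv * E' b.1 y₀ * E' (a.1 + b.1) y₀) * w) := by ring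
  rw [hW]
  exact isHadamard_resign hMhad (fun a => (hT' a.1).1 x₀) (fun b => hE'pm b.1 y₀)

end main

end Summit.Ventures.DiscreteObjects.Hadamard
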